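import Literature.Computability.MetaComplexity.MCSPDistinguisher
import Literature.Computability.MetaComplexity.MCSPStatisticalTest
import Literature.Computability.MetaComplexity.MCSPGeneratorCircuits
import HarnessLib

/-!
# An `MCSP` oracle breaks every polynomial-time generator family, uniformly (assembly; proofs)

Part of the proof architecture of the named fact `AllenderEtAl2006_MCSP_universalInverter`
(`MCSPUniversalInverter.lean`; Allender–Buhrman–Koucký–van Melkebeek–Ronneburger 2006, Thm. 45
with §4.2). This file assembles the non-HILL half of the printed proof of Thm. 45 (p. 24 of the
author version): for the dense test `L = {T : (T, ⌊√|T|⌋) ∉ MCSP} ∈ P^{MCSP}`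
(`MCSPStatisticalTest.lean`), every generator family `G_y : {0,1}^ℓ → {0,1}^{2ℓ}` computed in
polynomial time (`G ∈ FP`, parameter `|y| ≤ r(ℓ)`) is told apart from uniform by ONE probabilistic
polynomial-time oracle machine `M^L`, with advantage `≥ 1/p(ℓ)` at EVERY length `ℓ ≥ 1` and
uniformly in `y` — "this gives us a probabilistic oracle machine `M` using `L` that
distinguishes `G_y` from the uniform distribution. We then apply Theorem 44 [HILL]."

The depth of the GGM tree is fixed as `k(ℓ) = 4 · |bin D(ℓ)|` (`Nat.size`) for the polynomial
`D = S + 64`, `S` the circuit-size polynomial of the leaf-bit functions of `G`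
(`exists_poly_circuitSizeOver_ggmLab_le`): then `k · S(ℓ) + 2 ≤ D(ℓ)² < 2^{k/2} = ⌊√(2ᵏ)⌋` (the
test rejects every pseudorandom truth table, `truthTable_mem_compl_MCSPSize_iff`), `k/2 ≥ 5`
(at least half of all truth tables pass, `half_mul_le_card_compl_MCSPSize_sqrt`), and
`2^{k+1} ≤ 32 D(ℓ)⁴` (the gap `(1/2)/2ᵏ` of `distinguisher_gap` is `≥ 1/(32 D(ℓ)⁴)`, and
`k + ℓ + 2^{k+1} ℓ` coins fit in a polynomial budget).

* `four_mul_size_le` — `4 · |bin D| ≤ D` for `D ≥ 64` (and a private `2^{|bin D|} ≤ 2D`);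
* `depth_bounds` — the three numerical facts above;
* **`mcspTest_breaks_generators`** — the assembled statement, relative to a string function `h`
  computing the hybrid truth table (hypotheses `hFP : h ∈ FP` and the table specification
  `hh`, the target of the machine construction): there is a PPT oracle adversary `M` with
  `Pr_{z ← U_{2ℓ}}[M^L(⟨y,z⟩) = 1] − Pr_{s ← U_ℓ}[M^L(⟨y, G ⟨y,s⟩⟩) = 1] ≥ 1/(32 D(ℓ)⁴)` for all
  `ℓ ≥ 1` and all `|y| ≤ r(ℓ)`.

Theorems only.

## References

* E. Allender et al., *Power from random strings*, SIAM J. Comput. 35(6) (2006)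
  [AllenderEtAl2006]: Thm. 45 and its proof (pp. 23–24).
* A. A. Razborov, S. Rudich, *Natural proofs*, JCSS 55 (1997) [RazborovRudich1997]: Thm. 4.1.
* V. Kabanets, J.-Y. Cai, *Circuit minimization problem*, STOC 2000 [KabanetsCai2000], Thm. 8
  (`MCSP ∈ P/poly ⇒` no strong pseudorandom generators).
* S. Arora, B. Barak, *Computational Complexity: A Modern Approach*, CUP 2009 [AroraBarak2009]:
  proof of Thm. 9.17.
-/

namespace Literature.Computability.MetaComplexity

open _root_.Computability Complexity Cryptography Finset

/-! ### Numerical facts about the depth `k = 4 · |bin D|` -/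

/-- `4q + 4 ≤ 2^q` for `q ≥ 5`. [folklore] -/
private theorem four_mul_add_four_le_two_pow {q : ℕ} (hq : 5 ≤ q) : 4 * q + 4 ≤ 2 ^ q := by
  induction q, hq using Nat.le_induction with
  | base => norm_num
  | succ k hk ih => rw [pow_succ]; omega

/-- **`4 · |bin D| ≤ D` for `D ≥ 64`** (`Nat.size D ≤ D/4` since `D < 2^{D/4}`). [folklore] -/
theorem four_mul_size_le {D : ℕ} (hD : 64 ≤ D) : 4 * Nat.size D ≤ D := by
  have hq : 5 ≤ D / 4 := by omega
  have h1 := four_mul_add_four_le_two_pow hq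
  have h2 : D < 2 ^ (D / 4) := by omega
  have h3 : Nat.size D ≤ D / 4 := Nat.size_le.2 h2
  omega

/-- `2^{|bin D| - 1} ≤ D` for `D ≥ 1`, hence `2^{|bin D|} ≤ 2D` (private copy of the tree's
`Literature.ModelTheory.FiniteModelTheory.NExpr.two_pow_size_le`, whose import would be wrong
layering here). [folklore] -/
private theorem two_pow_size_le_two_mul {D : ℕ} (hD : 1 ≤ D) : 2 ^ Nat.size D ≤ 2 * D := by
  have hpos : 0 < Nat.size D := Nat.size_pos.2 hD
  have h : 2 ^ (Nat.size D - 1) ≤ D := Nat.lt_size.1 (by omega)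
  calc 2 ^ Nat.size D = 2 * 2 ^ (Nat.size D - 1) := by
        rw [← pow_succ']; congr 1; omega
    _ ≤ 2 * D := Nat.mul_le_mul_left 2 h

/-- **The depth bounds.** For `D ≥ 64`, `S + 64 ≤ D` and `k = 4 · |bin D|`: (i) `k = 2j` with
`j = 2|bin D| ≥ 5`; (ii) `k · S + 2 ≤ ⌊√(2ᵏ)⌋` (`= 2ʲ > D² ≥ 4|bin D| · S + 2`, by
`four_mul_size_le`); (iii) `2^{k+1} ≤ 32 D⁴`. [folklore]
[cite: AllenderEtAl2006, Thm. 45 (proof, p. 24: "We can pick k = O(log n) such that …")] -/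
theorem depth_bounds {D S : ℕ} (hD : 64 ≤ D) (hS : S + 64 ≤ D) :
    5 ≤ 2 * Nat.size D ∧
    4 * Nat.size D * S + 2 ≤ Nat.sqrt (2 ^ (4 * Nat.size D)) ∧
    2 ^ (4 * Nat.size D + 1) ≤ 32 * D ^ 4 := by
  have hsz : 7 ≤ Nat.size D := Nat.lt_size.2 (by
    calc 2 ^ 6 = 64 := by norm_num
      _ ≤ D := hD)
  have h4 := four_mul_size_le hD
  have hlt : D < 2 ^ Nat.size D := Nat.lt_size_self D
  have h2D := two_pow_size_le_two_mul (show 1 ≤ D by omega)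
  refine ⟨by omega, ?_, ?_⟩
  · -- (ii)
    have hsq : Nat.sqrt (2 ^ (4 * Nat.size D)) = 2 ^ (2 * Nat.size D) := by
      rw [show 4 * Nat.size D = 2 * (2 * Nat.size D) by ring, sqrt_two_pow_two_mul]
    rw [hsq]
    have hD2 : D * D < 2 ^ (2 * Nat.size D) := by
      calc D * D < 2 ^ Nat.size D * 2 ^ Nat.size D :=
            Nat.mul_lt_mul_of_lt_of_le hlt hlt.le (Nat.two_pow_pos _)
        _ = 2 ^ (2 * Nat.size D) := by rw [← pow_add]; congr 1; ring
    have hmain : 4 * Nat.size D * S + 2 ≤ D * D := by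
      have h1 : 4 * Nat.size D * S ≤ D * S := Nat.mul_le_mul_right S h4
      have h2 : D * S + 2 ≤ D * D := by nlinarith
      omega
    omega
  · -- (iii)
    calc 2 ^ (4 * Nat.size D + 1) = 2 * (2 ^ Nat.size D) ^ 4 := by
          rw [pow_succ, ← pow_mul]; ring
      _ ≤ 2 * (2 * D) ^ 4 := Nat.mul_le_mul_left 2 (Nat.pow_le_pow_left h2D 4)
      _ = 32 * D ^ 4 := by ring

/-! ### The assembled distinguisher -/

open scoped Classical in
/-- **An `MCSP` oracle breaks every polynomial-time generator family, uniformly** (the non-HILL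
half of ABK⁺06, proof of Thm. 45; Razborov–Rudich 1997, Thm. 4.1 and Kabanets–Cai 2000, Thm. 8,
in uniform oracle form). Let `G ∈ FP` double the length of seeds (`|G ⟨y, s⟩| = 2|s|`) and let
`r` bound the parameter length. There is a polynomial `D ≥ 64` (from the circuit-size polynomial
of the leaf-bit functions of `G`, `exists_poly_circuitSizeOver_ggmLab_le`) such that for EVERY
string function `h ∈ FP` computing, on `⟨⟨y, z⟩, ρ⟩` with `|z| = 2ℓ` and enough coins `ρ`, the
truth table of the depth-`k(ℓ)` (`k(ℓ) = 4|bin D(ℓ)|`) distinguisher tree of the halves of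
`s ↦ G ⟨y, s⟩` with step number, root and fresh labels parsed from `ρ` and the halves of `z` as
challenge (hypothesis `hh`), the one-query oracle adversary `M^L` built from `h` against the dense
test `L = (MCSPSize ⌊√(2ⁿ)⌋)ᶜ` satisfies, for all `ℓ ≥ 1` and all `|y| ≤ r(ℓ)`:
`Pr_{z ← U_{2ℓ}}[M^L(⟨y, z⟩) = 1] − Pr_{s ← U_ℓ}[M^L(⟨y, G ⟨y, s⟩⟩) = 1] ≥ 1 / (32 D(ℓ)⁴)`.
[cite: AllenderEtAl2006, Thm. 45 (proof, p. 24)] [cite: RazborovRudich1997, Thm. 4.1 proof]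
[cite: KabanetsCai2000, Thm. 8] -/
theorem mcspTest_breaks_generators {G : List Bool → List Bool} (hG : G ∈ FP)
    (hG2 : ∀ y s : List Bool, (G (boolPair y s)).length = 2 * s.length) (r : Polynomial ℕ) :
    ∃ D : Polynomial ℕ, (∀ ℓ, 64 ≤ D.eval ℓ) ∧
      ∀ (h : List Bool → List Bool), h ∈ FP →
        (∀ (ℓ : ℕ) (hℓ : 0 < ℓ) (y z ρ : List Bool), z.length = 2 * ℓ →
          4 * Nat.size (D.eval ℓ) + ℓ + 2 ^ (4 * Nat.size (D.eval ℓ) + 1) * ℓ ≤ ρ.length →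
          h (boolPair (boolPair y z) ρ) =
            truthTable (distFun
              (fun (b : Bool) (s' : Fin ℓ → Bool) (j : Fin ℓ) =>
                (G (boolPair y (List.ofFn s'))).getD (cond b (ℓ + j) j) false)
              (fun s' : Fin ℓ → Bool => s' ⟨0, hℓ⟩)
              ((fun j : Fin ℓ => ρ.getD (4 * Nat.size (D.eval ℓ) + j) false),
                fun (t : Fin (2 ^ (4 * Nat.size (D.eval ℓ)))) (b : Bool) (j : Fin ℓ) =>
                  ρ.getD (4 * Nat.size (D.eval ℓ) + ℓ + (2 * t + cond b 1 0) * ℓ + j) false)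
              (boolFunEquivFin (4 * Nat.size (D.eval ℓ)) fun t => ρ.getD t false)
              (fun (b : Bool) (j : Fin ℓ) => z.getD (cond b (ℓ + j) j) false))) →
        ∃ M : OracleAdversary Bool, M.IsPPT encodingBoolBool ∧
          ∀ (ℓ : ℕ), 0 < ℓ → ∀ y : List Bool, y.length ≤ r.eval ℓ →
            (1 : ℝ) / (32 * ((D.eval ℓ : ℕ) : ℝ) ^ 4) ≤
              uniformAvg (2 * ℓ) (fun z =>
                (M.outputPMF (Oracle.ofLanguage (MCSPSize fun n => Nat.sqrt (2 ^ n))ᶜ)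
                  (boolPair y z) (some true)).toReal) -
              uniformAvg ℓ (fun s =>
                (M.outputPMF (Oracle.ofLanguage (MCSPSize fun n => Nat.sqrt (2 ^ n))ᶜ)
                  (boolPair y (G (boolPair y s))) (some true)).toReal) := by
  classical
  -- the circuit-size polynomial of the leaf-bit functions and the depth polynomial
  obtain ⟨S, hS⟩ := exists_poly_circuitSizeOver_ggmLab_le hG r
  refine ⟨S + 64, fun ℓ => by simp, fun h hFP hh => ?_⟩
  set D : Polynomial ℕ := S + 64 with hDdef
  set A : Language Bool := (MCSPSize fun n => Nat.sqrt (2 ^ n))ᶜ with hA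
  -- the coin budget and the one-query adversary
  set c : Polynomial ℕ := D + Polynomial.X + 32 * D ^ 4 * Polynomial.X with hc
  obtain ⟨M, hM, hcoins, hlaw⟩ := exists_oracleAdversary_of_mem_FP hFP A c
  refine ⟨M, hM, fun ℓ hℓ y hy => ?_⟩
  have hDℓ : D.eval ℓ = S.eval ℓ + 64 := by simp [hDdef]
  have hD64 : 64 ≤ D.eval ℓ := by omega
  obtain ⟨hj5, hsmallN, hpowN⟩ := depth_bounds hD64 (le_of_eq hDℓ.symm)
  -- enough coins
  have hcK : ∀ z : List Bool, z.length = 2 * ℓ →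
      4 * Nat.size (D.eval ℓ) + ℓ + 2 ^ (4 * Nat.size (D.eval ℓ) + 1) * ℓ ≤
        c.eval (boolPair y z).length := by
    intro z hz
    have hℓw : ℓ ≤ (boolPair y z).length := by rw [length_boolPair, hz]; omega
    have hDm : D.eval ℓ ≤ D.eval (boolPair y z).length := TM2Iter.eval_mono D hℓw
    have h4 := four_mul_size_le hD64
    have hp : 2 ^ (4 * Nat.size (D.eval ℓ) + 1) * ℓ ≤ 32 * D.eval ℓ ^ 4 * ℓ :=
      Nat.mul_le_mul_right ℓ hpowN
    have hp' : 32 * D.eval ℓ ^ 4 * ℓ ≤ 32 * D.eval (boolPair y z).length ^ 4 * (boolPair y z).length :=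
      Nat.mul_le_mul (Nat.mul_le_mul_left 32 (Nat.pow_le_pow_left hDm 4)) hℓw
    simp only [hc, Polynomial.eval_add, Polynomial.eval_mul, Polynomial.eval_pow,
      Polynomial.eval_X, Polynomial.eval_ofNat]
    omega
  -- the specification at this `ℓ`, with the depth generalised to `m + 1`
  have hhℓ := hh ℓ hℓ y
  have hSℓ := hS ℓ (4 * Nat.size (D.eval ℓ)) y hy
  have hdens := half_mul_le_card_compl_MCSPSize_sqrt hj5
  rw [show 2 * (2 * Nat.size (D.eval ℓ)) = 4 * Nat.size (D.eval ℓ) by ring] at hdens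
  generalize hk : 4 * Nat.size (D.eval ℓ) = k at hhℓ hSℓ hdens hsmallN hpowN hcK
  obtain ⟨m, rfl⟩ : ∃ m, k = m + 1 := ⟨k - 1, by omega⟩
  -- the test rejects every GGM leaf-bit function
  have hsmall : ∀ x : Fin ℓ → Bool,
      truthTable (fun u : Fin (m + 1) → Bool =>
        ggmLab (fun (b : Bool) (s' : Fin ℓ → Bool) (j : Fin ℓ) =>
          (G (boolPair y (List.ofFn s'))).getD (cond b (ℓ + j) j) false) x (m + 1) u ⟨0, hℓ⟩) ∉ A := by
    intro x
    rw [hA, truthTable_mem_compl_MCSPSize_iff, not_lt]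
    exact (hSℓ x ⟨0, hℓ⟩).trans hsmallN
  -- the gap
  have hgap := distinguisher_gap (m := m) hℓ G y A h (fun z ρ hz hρ => hhℓ z ρ hz hρ) M c hlaw hcK
    (fun s hs => by rw [hG2, hs]) hsmall (B := 1 / 2) hdens
  refine le_trans ?_ hgap
  -- `1 / (32 D⁴) ≤ (1/2) / 2^(m+1)`
  have hDpos : (0 : ℝ) < ((D.eval ℓ : ℕ) : ℝ) := by exact_mod_cast (show 0 < D.eval ℓ by omega)
  have hpowR : (2 : ℝ) ^ (m + 1 + 1) ≤ 32 * ((D.eval ℓ : ℕ) : ℝ) ^ 4 := by exact_mod_cast hpowN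
  rw [div_div, div_le_div_iff₀ (by positivity) (by positivity), one_mul, one_mul,
    show (2 : ℝ) * 2 ^ (m + 1) = 2 ^ (m + 1 + 1) by ring]
  exact hpowR

end Literature.Computability.MetaComplexity
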